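/-
Copyright (c) 2026 the pub-hodgecm-mathlib formalisation cell (harness21).  Prover seat hodgecm-mathlib-K2E3-p26 (g2), Track B «K2-LIT» (valve hand → L1),
#184♮ = hLiu418 = `stmt-HodgeConjecture-24832`; socket #41, KIND 1, organ (K1b-W) «KIND W at `n := 1` for the pulled-back family» (line lead K2Liu-p14 (g4), FILE CUT
2026-09-04T22:32:01Z, LINE WORD #1 (3) «=» 22:42:47Z), brick (KW1-c) — THE HEAD (edition 1: the support letter `hsupp₁` from ONE per-place lattice letter in height∕valuation currency).
THEOREMS ONLY (no `def`, no `instance`, no notation, no named-fact hypothesis, no `sorry`); lane `--supports stmt-HodgeConjecture-24832` (count-neutral helper; closes no socket by itself).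
-/
import Summits.HodgeConjecture.HodgeConjecture.Theorems.K2LiuSiegelEisensteinKindWInstance   -- ★ (K2E4-p10): `hsupp_of_local`, `exists_den_of_local_letters` (per-place lattice letters ⟹ `hsupp`), `two_le_absNorm`
import Summits.HodgeConjecture.HodgeConjecture.Theorems.K2LiuLocalHeightLevelConjugation    -- ★ (c1) p862721 (this seat): `exists_localHeight_eq_pow` (`H_w(g) = q_w^a`, `a : ℕ`), `one_lt_absNorm_nnreal`
import HarnessLib

/-!
# Crux `HLiu418`, socket #41, (K1b-W) brick (KW1-c) — `K2LiuKindOneLineWhittakerSupport` (edition 1): THE SUPPORT LETTER `hsupp₁` OF THE LINE (`n = 1`) KIND-W BLOCK FROM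
# ONE PER-PLACE LATTICE LETTER «`A₁ μ s g ≠ 0 ⟹ |μ|_w ≤ exp(ℓ_w + k₀·a)` whenever `H_w(g) = q_w^a`»

Cell `hodgecm-mathlib`, crux item hLiu418 = `stmt-HodgeConjecture-24832` (helper lane `--supports … --as helper`, count-neutral), route of record `HCCMUnconditional`;
squad K2 ∕ K2Liu (L1, LEAD F0P6-plan (g14) BATCH #79∕#82), road `K2_Liu`, socket #41, KIND 1, organ (K1b-W) (line lead K2Liu-p14 (g4); FILE CUT 2026-09-04T22:32:01Z,
LINE WORDS #1 (3) ∕ #3), brick (KW1-c) of K2E3-p26 (g2)'s sub-cut (c1) ★ p862721 `K2LiuLocalHeightLevelConjugation` · (c2) ★ p862738 `K2LiuCharacterTrivialBallNormBound` · this HEAD.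
Author K2E3-p26 (g2).

THE OUTPUT is the `hsupp` binder of ★ `K2LiuKindOneLineWhittakerDecay.hdec₁_of_letters` (LH4-p09 (g10), (KW1-d)) and of the (KW1-f) package, BY VALUE and generic in the index
type `ι` (line indices, `mat : ι → Matrix (Fin 1) (Fin 1) L`), the point type `X` (LINE WORD #1 (1): `X := H(𝔸)` the BIG group, `ht := (↑)`, heights `‖g‖ = adelicHeightGL N L ↑g`,
`N := n + n`) and the `T`-part `A : ι → ℂ → X → ℂ` (`A₁`):
  `∃ CW κ, 0 < CW ∧ 0 ≤ κ ∧ ∀ i s x, 0 < re s → A i s x ≠ 0 → ∃ D : ℕ, 1 ≤ D ∧ (D : ℝ) ≤ CW·‖ht x‖^κ ∧ ∀ a b, IsIntegral ℤ (D · mat i a b)`.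
THE INPUT is ONE per-place letter in the currency the line's local files produce — ★ (c1) turns the local height into a level (`H_w(g) = q_w^a`, `g_w` conjugates `K_w(ϖ^{c+2a})`
into `K_w(ϖ^c)`), ★ S-a `K2LiuBadPlaceWhittakerSkewInstance.forall_addChar_eq_one_of_setIntegral_ne_zero` turns «local Whittaker integral `≠ 0`» into «character trivial on that
level's lattice», ★ (c2) turns that into a valuation bound — namely
  `hlat : ∀ i s x, 0 < re s → A i s x ≠ 0 → ∀ w a, H_w(ht x) = q_w^a → |mat i 0 0|_w ≤ exp(ℓ_w + k₀·a)`,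
with a defect `ℓ : places(L) → ℤ`, `ℓ_w ≤ 0` off a finite set `Tδ` (section level + character conductor + ramification of the index dress, all `0` at the generic place) and a slope
`k₀ : ℕ` (`= 2·e(w∣v) ≤ 4` for the corner translate).  The global-to-local seam `hA₁` («`A₁ ≠ 0` ⟹ each local factor `≠ 0`», payer = the (pkg) stage over ★ `KindWPartFubini`) and the
corner chart's level clause `hιK` live INSIDE the payer of `hlat` (LINE WORD #1 (3)(i)(ii)); this head is their common consumer.
* §1 `pow_toNat_add_mul_le` — the exponent bookkeeping `q^{ℓ⁺ + k₀a} = q^{ℓ⁺}·(q^a)^{k₀}` in `ℝ`, and `exp(ℓ + k₀a) ≤ exp(ℓ⁺ + k₀a)`.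
* §2 **`hsupp_line_of_latticeLetter`** — `hlat` at EVERY place ⟹ `hsupp₁` (★ `hsupp_of_local` with `δ_w := ℓ_w⁺`, `k := k₀`, `m_w := ℓ_w⁺ + k₀·a_w`, `a_w` from ★ `exists_localHeight_eq_pow`;
  `CW = (∏_{w∈Tδ} q_w^{ℓ_w⁺})·N^{k₀}`, `κ = k₀`).
* §3 **`hsupp_line_of_latticeLetter_off`** — the same with `hlat` required only ABOVE an exceptional set `U i x` of places of `L⁺` (the line's `U₁ μ g = kindWPlaces e₁ ↑T(g) μ 1`) and
  plain `w`-integrality of the index elsewhere (★ `K2LiuSiegelEisensteinKindWLetters.integral_of_not_mem_kindWPlaces`, `U₁ ⊇ D(μ)`): off `U` the witness is `m_w = ℓ_w⁺ + k₀·a_w ≥ 0`.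
[MoeglinWaldspurger1995, II.1.7]; [Shimura1997, §18.4 Prop. 18.14]; [Casselman1980, §3]; [BorelJacquet1979, §1.2].

HONEST LABEL.  Count-neutral helper, hypothesis-first on the lattice letter `hlat`; it retires nothing by itself: `HC_CM` is proved only modulo the 7 printed citations (2 remaining
named inputs: hLiu418 = `stmt-HodgeConjecture-24832`, h413 = `stmt-HodgeConjecture-24833`) until rung 0 closes.

## References
* [MoeglinWaldspurger1995] C. Mœglin, J.-L. Waldspurger, *Spectral decomposition and Eisenstein series*, Cambridge Tracts 113 (1995), II.1.7 (Fourier coefficients: support and growth).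
* [Shimura1997] G. Shimura, *Euler products and Eisenstein series*, CBMS 93 (1997), §18.4 Prop. 18.14 (bounded denominators of the Fourier indices).
* [Casselman1980] W. Casselman, *The unramified principal series of p-adic groups I*, Compositio Math. 40 (1980), §3 (lattice support of Whittaker functionals).
* [BorelJacquet1979] A. Borel, H. Jacquet, *Automorphic forms and automorphic representations*, Proc. Sympos. Pure Math. 33.1 (1979), §1.2 (heights), §4.1 (levels).
-/

set_option autoImplicit false
-- the mandated namespace repeats the single-problem summit's segment (`HodgeConjecture.HodgeConjecture`)
set_option linter.dupNamespace false

noncomputable section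

open scoped NNReal WithZero
open NumberField IsDedekindDomain
open Literature.NumberTheory.Automorphic

namespace Summit.HodgeConjecture.HodgeConjecture.Cruxes.HLiu418.K2LiuKindOneLineWhittakerSupport

open Summit.HodgeConjecture.HodgeConjecture.Cruxes.HLiu418.K2LiuSiegelEisensteinKindWInstance (hsupp_of_local)
open Summit.HodgeConjecture.HodgeConjecture.Cruxes.HLiu418.K2LiuLocalHeightLevelConjugation (exists_localHeight_eq_pow one_lt_absNorm_nnreal)

variable (L : Type) [Field L] [NumberField L]

/-! ## §1 Exponent bookkeeping -/

/-- `exp(ℓ + k₀·a) ≤ exp(ℓ⁺ + k₀·a)` in `ℤₘ₀` (`ℓ ≤ ℓ⁺ = Int.toNat ℓ`). [folklore] -/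
theorem exp_add_mul_le_exp_toNat_add_mul (ℓ : ℤ) (k₀ a : ℕ) :
    WithZero.exp (ℓ + (k₀ : ℤ) * (a : ℤ)) ≤ WithZero.exp (((ℓ.toNat + k₀ * a : ℕ) : ℤ)) := by
  rw [WithZero.exp_le_exp]
  push_cast
  have h := Int.self_le_toNat ℓ
  omega

/-- **`q^{ℓ⁺ + k₀·a} ≤ q^{ℓ⁺}·H^{k₀}` when `H = q^a`** (in `ℝ`, for the `hloc` bound of ★ `hsupp_of_local`; in fact an equality). [folklore] -/
theorem pow_toNat_add_mul_le (q : ℝ) (ℓ : ℤ) (k₀ a : ℕ) {H : ℝ} (hH : H = q ^ a) :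
    q ^ (ℓ.toNat + k₀ * a) ≤ q ^ ℓ.toNat * H ^ k₀ := by
  rw [hH, ← pow_mul, pow_add, mul_comm a k₀]

/-- The local height of ★ `GLn.localHeight` read in `ℝ`: `H_w(g) = q_w^a ⟹ (H_w(g) : ℝ) = (q_w : ℝ)^a`. [cite: BorelJacquet1979, §1.2] -/
theorem coe_localHeight_eq_pow {N : ℕ} {w : HeightOneSpectrum (𝓞 L)} {g : GL (Fin N) (AdeleRing (𝓞 L) L)} {a : ℕ}
    (h : GLn.localHeight N L w g = ((Ideal.absNorm w.asIdeal : ℕ) : ℝ≥0) ^ a) :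
    (GLn.localHeight N L w g : ℝ) = ((Ideal.absNorm w.asIdeal : ℕ) : ℝ) ^ a := by
  rw [h, NNReal.coe_pow, NNReal.coe_natCast]

/-! ## §2 The support letter from a lattice letter at every place -/

/-- **`hsupp₁` FROM THE PER-PLACE LATTICE LETTER** (the (KW1-c) head, edition 1).  Data: line indices `mat : ι → M₁(L)`, points `ht : X → GL_N(𝔸_L)` (`N ≥ 1`), the `T`-part
`A : ι → ℂ → X → ℂ`; a finite set `Tδ` of places of `L`, a defect `ℓ : places → ℤ` with `ℓ_w ≤ 0` off `Tδ`, a slope `k₀ : ℕ`.  LETTER `hlat`: whenever `A i s x ≠ 0` (`0 < re s`) and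
`H_w(ht x) = q_w^a` (`a : ℕ` — every local height is such a power, ★ `exists_localHeight_eq_pow`), the index satisfies `|mat i 0 0|_w ≤ exp(ℓ_w + k₀·a)`.  CONCLUSION: the TOP-shape
support letter `∃ CW κ, 0 < CW ∧ 0 ≤ κ ∧ ∀ i s x, 0 < re s → A i s x ≠ 0 → ∃ D : ℕ, 1 ≤ D ∧ D ≤ CW·‖ht x‖^κ ∧ ∀ a b, IsIntegral ℤ (D·mat i a b)` — ★ `hsupp_of_local` with `δ_w = ℓ_w⁺`,
`k = k₀`, and at the place `w` the witness `m_w = ℓ_w⁺ + k₀·a_w` (`q_w^{m_w} = q_w^{ℓ_w⁺}·H_w^{k₀}`, `|mat i a b|_w = |mat i 0 0|_w ≤ exp(ℓ_w + k₀a_w) ≤ exp m_w`).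
[cite: MoeglinWaldspurger1995, II.1.7] [cite: Shimura1997, §18.4 Prop. 18.14] [cite: Casselman1980, §3] -/
theorem hsupp_line_of_latticeLetter {ι X : Type*} {N : ℕ} [NeZero N] (mat : ι → Matrix (Fin 1) (Fin 1) L) (ht : X → GL (Fin N) (AdeleRing (𝓞 L) L))
    (A : ι → ℂ → X → ℂ) (Tδ : Finset (HeightOneSpectrum (𝓞 L))) (ℓ : HeightOneSpectrum (𝓞 L) → ℤ) (hℓ : ∀ w ∉ Tδ, ℓ w ≤ 0) (k₀ : ℕ)
    (hlat : ∀ (i : ι) (s : ℂ) (x : X), 0 < s.re → A i s x ≠ 0 → ∀ (w : HeightOneSpectrum (𝓞 L)) (a : ℕ),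
      GLn.localHeight N L w (ht x) = ((Ideal.absNorm w.asIdeal : ℕ) : ℝ≥0) ^ a →
        Valued.v ((mat i 0 0 : L) : w.adicCompletion L) ≤ WithZero.exp (ℓ w + (k₀ : ℤ) * (a : ℤ))) :
    ∃ CW κ : ℝ, 0 < CW ∧ 0 ≤ κ ∧ ∀ (i : ι) (s : ℂ) (x : X), 0 < s.re → A i s x ≠ 0 →
      ∃ D : ℕ, 1 ≤ D ∧ (D : ℝ) ≤ CW * adelicHeightGL N L (ht x) ^ κ ∧ ∀ a b, IsIntegral ℤ ((D : L) * mat i a b) := by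
  refine hsupp_of_local L mat ht A Tδ (fun w => (ℓ w).toNat) (fun w hw => Int.toNat_of_nonpos (hℓ w hw)) k₀ fun i s x hs hA w => ?_
  obtain ⟨a, ha⟩ := exists_localHeight_eq_pow L w (ht x)
  refine ⟨(ℓ w).toNat + k₀ * a, pow_toNat_add_mul_le _ (ℓ w) k₀ a (coe_localHeight_eq_pow L ha), fun a' b' => ?_⟩
  rw [Fin.fin_one_eq_zero a', Fin.fin_one_eq_zero b']
  exact (hlat i s x hs hA w a ha).trans (exp_add_mul_le_exp_toNat_add_mul (ℓ w) k₀ a)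

/-! ## §3 The same with the lattice letter only above an exceptional set and integrality elsewhere -/

/-- **`hsupp₁` FROM THE LATTICE LETTER ABOVE `U` AND INTEGRALITY OFF `U`.**  As §2, but `hlat` is required only at the places `w` of `L` lying over the exceptional set `U i x` of places
of `L⁺` (for the line: `U₁ μ g = kindWPlaces e₁ ↑T(g) μ 1`, LINE WORD #1 (1)), while off `U i x` the index is `w`-integral (`hint`; for the line this is ★
`K2LiuSiegelEisensteinKindWLetters.integral_of_not_mem_kindWPlaces`, `U₁ ⊇ D(μ)`) — there the witness `m_w = ℓ_w⁺ + k₀·a_w ≥ 0` works with `|mat i 0 0|_w ≤ 1 = exp 0 ≤ exp m_w`.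
[cite: MoeglinWaldspurger1995, II.1.7] [cite: Shimura1997, §18.4 Prop. 18.14] [cite: BorelJacquet1979, §1.2] -/
theorem hsupp_line_of_latticeLetter_off {ι X : Type*} {N : ℕ} [NeZero N] (mat : ι → Matrix (Fin 1) (Fin 1) L) (ht : X → GL (Fin N) (AdeleRing (𝓞 L) L))
    (A : ι → ℂ → X → ℂ) (Tδ : Finset (HeightOneSpectrum (𝓞 L))) (ℓ : HeightOneSpectrum (𝓞 L) → ℤ) (hℓ : ∀ w ∉ Tδ, ℓ w ≤ 0) (k₀ : ℕ)
    (U : ι → X → Set (HeightOneSpectrum (𝓞 ↥(maximalRealSubfield L))))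
    (hint : ∀ (i : ι) (x : X) (w : HeightOneSpectrum (𝓞 L)), w.under (𝓞 ↥(maximalRealSubfield L)) ∉ U i x →
      Valued.v ((mat i 0 0 : L) : w.adicCompletion L) ≤ 1)
    (hlat : ∀ (i : ι) (s : ℂ) (x : X), 0 < s.re → A i s x ≠ 0 → ∀ (w : HeightOneSpectrum (𝓞 L)) (a : ℕ),
      w.under (𝓞 ↥(maximalRealSubfield L)) ∈ U i x →
      GLn.localHeight N L w (ht x) = ((Ideal.absNorm w.asIdeal : ℕ) : ℝ≥0) ^ a →
        Valued.v ((mat i 0 0 : L) : w.adicCompletion L) ≤ WithZero.exp (ℓ w + (k₀ : ℤ) * (a : ℤ))) :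
    ∃ CW κ : ℝ, 0 < CW ∧ 0 ≤ κ ∧ ∀ (i : ι) (s : ℂ) (x : X), 0 < s.re → A i s x ≠ 0 →
      ∃ D : ℕ, 1 ≤ D ∧ (D : ℝ) ≤ CW * adelicHeightGL N L (ht x) ^ κ ∧ ∀ a b, IsIntegral ℤ ((D : L) * mat i a b) := by
  refine hsupp_of_local L mat ht A Tδ (fun w => (ℓ w).toNat) (fun w hw => Int.toNat_of_nonpos (hℓ w hw)) k₀ fun i s x hs hA w => ?_
  obtain ⟨a, ha⟩ := exists_localHeight_eq_pow L w (ht x)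
  refine ⟨(ℓ w).toNat + k₀ * a, pow_toNat_add_mul_le _ (ℓ w) k₀ a (coe_localHeight_eq_pow L ha), fun a' b' => ?_⟩
  rw [Fin.fin_one_eq_zero a', Fin.fin_one_eq_zero b']
  by_cases hw : w.under (𝓞 ↥(maximalRealSubfield L)) ∈ U i x
  · exact (hlat i s x hs hA w a hw ha).trans (exp_add_mul_le_exp_toNat_add_mul (ℓ w) k₀ a)
  · refine (hint i x w hw).trans ?_
    rw [← WithZero.exp_zero, WithZero.exp_le_exp]
    exact_mod_cast Nat.zero_le _

end Summit.HodgeConjecture.HodgeConjecture.Cruxes.HLiu418.K2LiuKindOneLineWhittakerSupport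

end
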